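import Summits.QuantumFields.YangMills.Theorems.UnitScaleTiltProp7LatticeScaleTelescoping
import Summits.QuantumFields.YangMills.Theorems.UnitScaleTiltProp7CornerCombStructure
import HarnessLib

/-!
# (n3)-COMB (II) «COMB = STRAIGHT ∘ BLOCK-AXIAL», file F-6c-3: THE CHAIN PER CORNER — the covariant coarse gradient of the accumulated gauge function `Λ_k` at ONE level-`k` bond
# `(z, κ)`, from the per-scale rows of the normalised transported block means, the top pair, and the in-cell oscillations (organisation β of ★routeR-w1 g9's PENS ROUND 3, 2026-08-29)

Crux `stmt-QuantumFields-19200` `MinimiserStabilityRegPr`, route-R E′ (A′)-on-Σ, package P-A2, row (β); the DISPLAYED route-internal row `hMcomb` («(n3)-comb», SIGNATURE-0,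
★★OWNER RULINGS №19 O4 ∕ №22; OPEN, XL) and its supplier design (II) (MASTER `DESIGN-N3COMB-LINEAR-CORE` 6efb31c3 §1 rows 7–8, §5 F-6c; PENS ROUND 3 of 2026-08-29T08:01:48Z, item (iv)).
Seat `ym-ust-19200-w3` g13 (pen «F-6c-3» by first «MINE» 08:06:38Z under ★routeR-w1 g9's PENS ROUND 3); `--kind proof --supports stmt-QuantumFields-19200 --as helper`; THEOREMS ONLY
(0 `def`, 0 `sorry`); «(O2) groundwork — not consumed by any displayed row before the freeze lifts»; count-neutral.  YM₃ on T³ is a ladder rung (R3), NOT d = 4, NOT infinite volume, NOT the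
Clay problem; nothing here is progress on the YM mass gap; nothing of `hMcomb` ∕ `hMcomb₂` ∕ (β) ∕ `hD` ∕ the stub ∕ the crux is proved or claimed.

## The mechanism (MASTER §1 rows 7–8, organisation β)
At a level-`k` corner `z` the accumulated gauge function of ✓`Prop7CornerCombStructure.cornerComb_structure` unrolls along the corner chain (§2 `gauge_unroll`):
`Λ_k(z) = Σ_{i<k} CM_i(G_i)(L^{k−1−i}•z)`, and each corner charge splits (F-6a-2 ✓`norm_FhatCov_sub_drift_sq_le`) into the DRIFT `Σ_μ ((L−1)∕2)·Lⁱ • m⁽ⁱ⁾_μ(z)` of the NORMALISED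
transported block means `m⁽ⁱ⁾_μ(z) = L⁻ⁱ • X̄^{cov,i}_μ(q_i(z))` plus an oscillation `o_i(z)`.  The covariant coarse gradient `Λ_k(z) − Ad_{Ū₀ᵏ(z,κ)}Λ_k(z + e_κ)` is then, EXACTLY (§1
`sum_smul_eq_top_sub_chain`, summation by parts), the TOP PAIR `((Lᵏ−1)∕2)·[m⁽ᵏ⁻¹⁾(z) − Ad m⁽ᵏ⁻¹⁾(z+e_κ)]` minus the two scale chains `Σ_{j<k−1} ((L^{j+1}−1)∕2)·[Δ_j(z) − Ad Δ_j(z+e_κ)]`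
(`Δ_j = m⁽ʲ⁺¹⁾ − m⁽ʲ⁾`, weights `Σ_{i≤j} ((L−1)∕2)Lⁱ = (L^{j+1}−1)∕2`) plus the oscillations; Cauchy–Schwarz over scales with the weights `θ_j = (√L)^{k−2−j}` (§1 `geom_sum_inv_sqrt_rev_le`:
`Σ_j θ_j⁻¹ ≤ c_L = (1 − (√L)⁻¹)⁻¹`, ✓`Prop7LatticeScaleTelescoping.sq_sum_le_sum_inv_mul_sum`) gives the per-corner row ★ `normSq_covGrad_le_of_rows` with NO growth assumption on the
local energies (the growth `L^{(4−d)i}` is GLOBAL and is F-6d's: after the sum over corners the weight `(√L)^{k−2−j}` meets `Σ‖∇^{cov}G_j‖² ≲ Lʲ·Σ‖∇Y₀‖²`, total `≲ c_L²·Lᵏ`, `k`-free).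

## What is here (every constant a closed numeral in `(d, L)`; NOTHING depends on `k`, the torus, `K`, `n`, the member)
* §1 (any real normed space `E`, any finite direction type `ι`): `sum_halfPow_eq` (`Σ_{i<k}((L−1)∕2)Lⁱ = (Lᵏ−1)∕2`), `sum_smul_eq_top_sub_chain` (summation by parts),
  `geom_sum_inv_sqrt_rev_le`, `sq_sum_le_cL_mul_sum` (the reversed-weight Cauchy–Schwarz), ★ `normSq_covGrad_le_of_rows` — THE ABSTRACT PER-CORNER ROW: for vectors
  `a b : ℕ → ι → E` (the means at `z` and the TRANSPORTED means at `z + e_κ`), `o p : ℕ → E` (oscillations, transported oscillations) with `‖a (j+1) μ − a j μ‖² ≤ Da j μ`,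
  `‖b (j+1) μ − b j μ‖² ≤ Db j μ` (`j + 1 < k`), `‖a (k−1) μ − b (k−1) μ‖² ≤ P μ`, `‖o i‖² ≤ O i`, `‖p i‖² ≤ O′ i` (`i < k`):
  `‖Σ_{i<k}(Σ_μ wᵢ•a i μ + o i) − Σ_{i<k}(Σ_μ wᵢ•b i μ + p i)‖² ≤ 3·[ |ι|·((Lᵏ−1)∕2)²·Σ_μ P μ + 2|ι|·c_L·Σ_{j<k−1}(√L)^{k−2−j}·((L^{j+1}−1)∕2)²·Σ_μ(Da j μ + Db j μ) + 2c_L·Σ_{i<k}(√L)^{k−1−i}·(O i + O′ i) ]`.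
* §2 (the letters of ✓`cornerComb_structure`, any `CM`): `gauge_unroll` — `Λ k z = Σ_{i<k} CM i (G i) ((L^{k−1−i} : ℤ) • z)`; `covGrad_gauge_eq_sum` — the covariant coarse gradient of
  `Λ_k` at `(z, κ)` as `Σ_{i<k} [CM i (G i)(L^{k−1−i}•z) − Ad_{Ū₀ᵏ(z,κ)} CM i (G i)(L^{k−1−i}•(z+e_κ))]`; `norm_conjR_sub_conjR_le` (transport is non-expansive on differences).
NOT HERE: the one-scale rows themselves (F-6c-1∕F-6c-2: straight-step mean identity, dressed Jensen + Poincaré on `Q_i`), the in-cell oscillation row (✓F-6a-2), the sum over corners,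
block multiplicities, the global gradient transfer and Weitzenböck (F-6d).
HONEST: normed-space bookkeeping (telescoping, summation by parts, weighted Cauchy–Schwarz) and one unrolling identity; no estimate of Bałaban's beyond the cited tree theorems.
References: T. Bałaban, CMP 98 (1985) 17–51 [Balaban1985Averaging] ((43) p.24, (68) p.29, (112) p.34); CMP 96 (1984) 223–250 [Balaban1984PropagatorsII] ((1.9) p.226);
M. Giaquinta, Multiple integrals in the calculus of variations (1983) [Giaquinta1984] (Ch. III §1 p.70).
-/

set_option autoImplicit false

open scoped BigOperators
open Finset

namespace Summit.QuantumFields.YangMills.Theorems.Prop7CornerCombChainPerCorner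

open Summit.QuantumFields.YangMills.Theorems.Prop7LatticeScaleTelescoping (sq_sum_le_sum_inv_mul_sum geom_sum_inv_sqrt_le)

/-! ## §1 The abstract per-corner row -/

section Abstract

variable {ι : Type*} [Fintype ι] {E : Type*} [NormedAddCommGroup E] [NormedSpace ℝ E]

/-- The drift weights sum to the top weight: `Σ_{i<k} ((L−1)∕2)·Lⁱ = (Lᵏ − 1)∕2`. [folklore] [cite: Balaban1985Averaging, pp.24-25] -/
theorem sum_halfPow_eq (L : ℝ) (k : ℕ) : ∑ i ∈ range k, (L - 1) / 2 * L ^ i = (L ^ k - 1) / 2 := by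
  rw [← geom_sum_mul L k, Finset.sum_mul, Finset.sum_div]
  exact Finset.sum_congr rfl fun i _ => by ring

/-- The partial drift weights: `Σ_{i<j+1} ((L−1)∕2)·Lⁱ = (L^{j+1} − 1)∕2` — the weight of the `j`-th scale step in the summation by parts. [folklore] [cite: Balaban1985Averaging, pp.24-25] -/
theorem sum_halfPow_range_succ_eq (L : ℝ) (j : ℕ) : ∑ i ∈ range (j + 1), (L - 1) / 2 * L ^ i = (L ^ (j + 1) - 1) / 2 :=
  sum_halfPow_eq L (j + 1)

omit [NormedSpace ℝ E] in
/-- **TELESCOPING TO THE TOP**: for `i < k`, `a i = a (k−1) − Σ_{j∈[i,k−1)} (a (j+1) − a j)`. [folklore] [cite: Giaquinta1984, Ch. III §1 p.70] -/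
theorem eq_top_sub_sum_Ico (a : ℕ → E) {i k : ℕ} (hik : i < k) :
    a i = a (k - 1) - ∑ j ∈ Ico i (k - 1), (a (j + 1) - a j) := by
  -- `Σ_{j∈[i,k−1)} (a (j+1) − a j) = a (k−1) − a i`
  have h' : ∑ j ∈ Ico i (k - 1), (a (j + 1) - a j) = a (k - 1) - a i := by
    have h := Finset.sum_range_sub (fun t => a (i + t)) (k - 1 - i)
    rw [Nat.add_zero, show i + (k - 1 - i) = k - 1 by omega] at h
    rw [Finset.sum_Ico_eq_sum_range]
    exact h
  rw [h']; abel

/-- **SUMMATION BY PARTS OF THE DRIFT** (`1 ≤ k`): `Σ_{i<k} wᵢ•a i = (Σ_{i<k} wᵢ)•a (k−1) − Σ_{j<k−1} (Σ_{i≤j} wᵢ)•(a (j+1) − a j)` — every scale step `Δ_j = a (j+1) − a j` is weighted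
by the drift weights BELOW it. [folklore] [cite: Giaquinta1984, Ch. III §1 p.70; Balaban1985Averaging, pp.24-25] -/
theorem sum_smul_eq_top_sub_chain (w : ℕ → ℝ) (a : ℕ → E) {k : ℕ} (hk : 1 ≤ k) :
    ∑ i ∈ range k, w i • a i
      = (∑ i ∈ range k, w i) • a (k - 1) - ∑ j ∈ range (k - 1), (∑ i ∈ range (j + 1), w i) • (a (j + 1) - a j) := by
  -- expand `a i` to the top and swap the sums
  have hexp : ∑ i ∈ range k, w i • a i = ∑ i ∈ range k, (w i • a (k - 1) - ∑ j ∈ Ico i (k - 1), w i • (a (j + 1) - a j)) := by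
    refine Finset.sum_congr rfl fun i hi => ?_
    have h := congrArg (fun v => w i • v) (eq_top_sub_sum_Ico a (Finset.mem_range.mp hi))
    simp only [smul_sub] at h
    rw [Finset.smul_sum] at h
    exact h
  rw [hexp, Finset.sum_sub_distrib, Finset.sum_smul]
  congr 1
  -- swap: `Σ_{i<k} Σ_{j∈[i,k−1)} = Σ_{j<k−1} Σ_{i≤j}`
  rw [Finset.sum_comm' (s := range k) (t := fun i => Ico i (k - 1)) (t' := range (k - 1)) (s' := fun j => range (j + 1))]
  · exact Finset.sum_congr rfl fun j _ => (Finset.sum_smul).symm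
  · intro i j
    simp only [Finset.mem_range, Finset.mem_Ico]
    omega

/-- The reversed geometric series of the scale weights: for `1 < L`, `Σ_{j<n} ((√L)^{n−1−j})⁻¹ ≤ (1 − (√L)⁻¹)⁻¹ =: c_L` — independent of `n`. [folklore] [cite: Giaquinta1984, Ch. III §1 p.70] -/
theorem geom_sum_inv_sqrt_rev_le {L : ℝ} (hL : 1 < L) (n : ℕ) :
    ∑ j ∈ range n, ((Real.sqrt L) ^ (n - 1 - j))⁻¹ ≤ (1 - (Real.sqrt L)⁻¹)⁻¹ := by
  have h := geom_sum_inv_sqrt_le hL 0 n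
  rw [← Finset.range_eq_Ico] at h
  refine le_trans (le_of_eq ?_) h
  rw [← Finset.sum_range_reflect]
  refine Finset.sum_congr rfl fun j hj => ?_
  rw [Finset.mem_range] at hj
  congr 2
  omega

/-- **CAUCHY–SCHWARZ OVER SCALES WITH THE REVERSED WEIGHTS `θ_j = (√L)^{n−1−j}`**: `(Σ_{j<n} x_j)² ≤ c_L·Σ_{j<n} (√L)^{n−1−j}·x_j²` — NO growth assumption on the `x_j`
(the weight penalises the LOW scales; the consumer's global energies grow like `Lʲ` and pay for it). [folklore] [cite: Giaquinta1984, Ch. III §1 p.70] -/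
theorem sq_sum_le_cL_mul_sum {L : ℝ} (hL : 1 < L) (n : ℕ) (x : ℕ → ℝ) :
    (∑ j ∈ range n, x j) ^ 2 ≤ (1 - (Real.sqrt L)⁻¹)⁻¹ * ∑ j ∈ range n, (Real.sqrt L) ^ (n - 1 - j) * x j ^ 2 := by
  have hs0 : 0 < Real.sqrt L := Real.sqrt_pos.2 (zero_lt_one.trans hL)
  have hθ : ∀ j ∈ range n, 0 < (Real.sqrt L) ^ (n - 1 - j) := fun j _ => pow_pos hs0 _
  have h1 := sq_sum_le_sum_inv_mul_sum (range n) x (fun j => (Real.sqrt L) ^ (n - 1 - j)) hθ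
  have h2 := geom_sum_inv_sqrt_rev_le hL n
  have hB : 0 ≤ ∑ j ∈ range n, (Real.sqrt L) ^ (n - 1 - j) * x j ^ 2 :=
    Finset.sum_nonneg fun j hj => mul_nonneg (hθ j hj).le (sq_nonneg _)
  exact h1.trans (mul_le_mul_of_nonneg_right h2 hB)

/-- `(Σ_{μ} x_μ)² ≤ |ι|·Σ_μ x_μ²` (Cauchy–Schwarz over the directions). [folklore] [cite: Giaquinta1984, Ch. III §1 p.70] -/
theorem sq_sum_le_card_mul_sum_sq_univ (x : ι → ℝ) : (∑ μ, x μ) ^ 2 ≤ (Fintype.card ι : ℝ) * ∑ μ, x μ ^ 2 := by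
  have h := sq_sum_le_sum_inv_mul_sum (Finset.univ : Finset ι) x (fun _ => (1 : ℝ)) (fun _ _ => one_pos)
  simpa only [inv_one, Finset.sum_const, Finset.card_univ, nsmul_eq_mul, mul_one, one_mul] using h

/-- ★ **THE ABSTRACT PER-CORNER ROW (organisation β, PENS ROUND 3 (iv))**.  Data at one level-`k` bond `(z, κ)` (`1 ≤ k`, `1 < L`): the normalised transported block means `a i μ`
(`= m⁽ⁱ⁾_μ(z)`) and `b i μ` (`= Ad_{Ū₀ᵏ(z,κ)} m⁽ⁱ⁾_μ(z + e_κ)`), the oscillations `o i` (at `z`) and `p i` (transported, at `z + e_κ`), drift weights `wᵢ = ((L−1)∕2)·Lⁱ`.  HYPOTHESES = the rows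
of F-6c-2 ∕ F-6a-2 read at this corner, NO growth assumption: one-scale rows `‖a (j+1) μ − a j μ‖² ≤ Da j μ`, `‖b (j+1) μ − b j μ‖² ≤ Db j μ` (`j + 1 < k`), the top pair
`‖a (k−1) μ − b (k−1) μ‖² ≤ P μ`, the oscillation rows `‖o i‖² ≤ O i`, `‖p i‖² ≤ O′ i` (`i < k`).  CONCLUSION (summation by parts + Cauchy–Schwarz over scales with `θ_j = (√L)^{k−2−j}`,
`c_L = (1 − (√L)⁻¹)⁻¹`):
`‖Σ_{i<k}(Σ_μ wᵢ•a i μ + o i) − Σ_{i<k}(Σ_μ wᵢ•b i μ + p i)‖² ≤ 3·[ |ι|·((Lᵏ−1)∕2)²·Σ_μ P μ + 2|ι|·c_L·Σ_{j<k−1} (√L)^{k−2−j}·((L^{j+1}−1)∕2)²·Σ_μ (Da j μ + Db j μ) + 2c_L·Σ_{i<k} (√L)^{k−1−i}·(O i + O′ i) ]`.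
With `Da j μ = L^{−2j}·E_j(z)` the scale factor `((L^{j+1}−1)∕2)²·L^{−2j} ≤ L²∕4` is level-free: the weight `(√L)^{k−2−j}` is what the GLOBAL transfer `Σ‖∇^{cov}G_j‖² ≲ L^{(4−d)j}·Σ‖∇Y₀‖²` (F-6d,
★routeR-w4 F-6b) pays for in `d = 3`, total `≲ c_L²·Lᵏ`, `k`-free. [cite: Balaban1985Averaging, (43) p.24, (68) p.29, (112) p.34; Balaban1984PropagatorsII, (1.9) p.226; Giaquinta1984, Ch. III §1 Thm 1.2 p.70] -/
theorem normSq_covGrad_le_of_rows {L : ℝ} (hL : 1 < L) {k : ℕ} (hk : 1 ≤ k)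
    (a b : ℕ → ι → E) (o p : ℕ → E) (Da Db : ℕ → ι → ℝ) (P : ι → ℝ) (O O' : ℕ → ℝ)
    (ha : ∀ j, j + 1 < k → ∀ μ, ‖a (j + 1) μ - a j μ‖ ^ 2 ≤ Da j μ)
    (hb : ∀ j, j + 1 < k → ∀ μ, ‖b (j + 1) μ - b j μ‖ ^ 2 ≤ Db j μ)
    (hP : ∀ μ, ‖a (k - 1) μ - b (k - 1) μ‖ ^ 2 ≤ P μ)
    (ho : ∀ i < k, ‖o i‖ ^ 2 ≤ O i) (hp : ∀ i < k, ‖p i‖ ^ 2 ≤ O' i) :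
    ‖(∑ i ∈ range k, ((∑ μ, ((L - 1) / 2 * L ^ i) • a i μ) + o i)) - ∑ i ∈ range k, ((∑ μ, ((L - 1) / 2 * L ^ i) • b i μ) + p i)‖ ^ 2
      ≤ 3 * ((Fintype.card ι : ℝ) * ((L ^ k - 1) / 2) ^ 2 * ∑ μ, P μ
          + 2 * (Fintype.card ι : ℝ) * (1 - (Real.sqrt L)⁻¹)⁻¹
              * ∑ j ∈ range (k - 1), (Real.sqrt L) ^ (k - 2 - j) * ((L ^ (j + 1) - 1) / 2) ^ 2 * ∑ μ, (Da j μ + Db j μ)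
          + 2 * (1 - (Real.sqrt L)⁻¹)⁻¹ * ∑ i ∈ range k, (Real.sqrt L) ^ (k - 1 - i) * (O i + O' i)) := by
  have hL0 : 0 < L := zero_lt_one.trans hL
  have hs1 : 1 < Real.sqrt L := by rw [← Real.sqrt_one]; exact Real.sqrt_lt_sqrt zero_le_one hL
  have hs0 : 0 < Real.sqrt L := zero_lt_one.trans hs1
  have hcL : 0 ≤ (1 - (Real.sqrt L)⁻¹)⁻¹ := inv_nonneg.2 (by rw [sub_nonneg]; exact inv_le_one_of_one_le₀ hs1.le)
  -- two elementary real inequalities (kept local: `(x+y)² ≤ 2x²+2y²`, `(x+y+z)² ≤ 3(x²+y²+z²)`)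
  have add_sq_le_two : ∀ x y : ℝ, (x + y) ^ 2 ≤ 2 * x ^ 2 + 2 * y ^ 2 := fun x y => by nlinarith [sq_nonneg (x - y)]
  have add_add_sq_le_three : ∀ x y t : ℝ, (x + y + t) ^ 2 ≤ 3 * (x ^ 2 + y ^ 2 + t ^ 2) := fun x y t => by
    nlinarith [sq_nonneg (x - y), sq_nonneg (y - t), sq_nonneg (x - t)]
  -- names
  set w : ℕ → ℝ := fun i => (L - 1) / 2 * L ^ i with hw
  set W : ℝ := (L ^ k - 1) / 2 with hW
  set W' : ℕ → ℝ := fun j => (L ^ (j + 1) - 1) / 2 with hW'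
  set T : ι → E := fun μ => a (k - 1) μ - b (k - 1) μ with hT
  set Δa : ℕ → ι → E := fun j μ => a (j + 1) μ - a j μ with hΔa
  set Δb : ℕ → ι → E := fun j μ => b (j + 1) μ - b j μ with hΔb
  have hWsum : ∑ i ∈ range k, w i = W := sum_halfPow_eq L k
  have hW'sum : ∀ j, ∑ i ∈ range (j + 1), w i = W' j := fun j => sum_halfPow_range_succ_eq L j
  have hW0 : 0 ≤ W := by rw [hW]; have := one_le_pow₀ (M₀ := ℝ) hL.le (n := k); linarith
  have hW'0 : ∀ j, 0 ≤ W' j := fun j => by rw [hW']; dsimp only; have := one_le_pow₀ (M₀ := ℝ) hL.le (n := j + 1); linarith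
  -- Step A: the summation-by-parts identity for the vector
  have hA : (∑ i ∈ range k, ((∑ μ, w i • a i μ) + o i)) - ∑ i ∈ range k, ((∑ μ, w i • b i μ) + p i)
      = ∑ μ, (W • T μ - ∑ j ∈ range (k - 1), W' j • (Δa j μ - Δb j μ)) + ∑ i ∈ range k, (o i - p i) := by
    have hsa : ∀ μ, ∑ i ∈ range k, w i • a i μ = W • a (k - 1) μ - ∑ j ∈ range (k - 1), W' j • Δa j μ := by
      intro μ
      rw [sum_smul_eq_top_sub_chain w (fun i => a i μ) hk, hWsum]
      simp only [hW'sum, hΔa]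
    have hsb : ∀ μ, ∑ i ∈ range k, w i • b i μ = W • b (k - 1) μ - ∑ j ∈ range (k - 1), W' j • Δb j μ := by
      intro μ
      rw [sum_smul_eq_top_sub_chain w (fun i => b i μ) hk, hWsum]
      simp only [hW'sum, hΔb]
    rw [Finset.sum_add_distrib, Finset.sum_add_distrib, Finset.sum_comm (s := range k), Finset.sum_comm (s := range k) (f := fun i μ => w i • b i μ)]
    simp only [hsa, hsb, hT, smul_sub, Finset.sum_sub_distrib]
    abel
  -- Step B: the norm
  have hB : ‖(∑ i ∈ range k, ((∑ μ, w i • a i μ) + o i)) - ∑ i ∈ range k, ((∑ μ, w i • b i μ) + p i)‖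
      ≤ W * ∑ μ, ‖T μ‖ + ∑ j ∈ range (k - 1), W' j * ∑ μ, (‖Δa j μ‖ + ‖Δb j μ‖) + ∑ i ∈ range k, (‖o i‖ + ‖p i‖) := by
    rw [hA]
    refine (norm_add_le _ _).trans (add_le_add ?_ ?_)
    · refine (norm_sum_le _ _).trans ?_
      have hμ : ∀ μ, ‖W • T μ - ∑ j ∈ range (k - 1), W' j • (Δa j μ - Δb j μ)‖
          ≤ W * ‖T μ‖ + ∑ j ∈ range (k - 1), W' j * (‖Δa j μ‖ + ‖Δb j μ‖) := by
        intro μ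
        refine (norm_sub_le _ _).trans (add_le_add ?_ ?_)
        · rw [norm_smul, Real.norm_of_nonneg hW0]
        · refine (norm_sum_le _ _).trans (Finset.sum_le_sum fun j _ => ?_)
          rw [norm_smul, Real.norm_of_nonneg (hW'0 j)]
          exact mul_le_mul_of_nonneg_left (norm_sub_le _ _) (hW'0 j)
      refine (Finset.sum_le_sum fun μ _ => hμ μ).trans (le_of_eq ?_)
      rw [Finset.sum_add_distrib, Finset.mul_sum, Finset.sum_comm]
      congr 1
      exact Finset.sum_congr rfl fun j _ => by rw [Finset.mul_sum]
    · exact (norm_sum_le _ _).trans (Finset.sum_le_sum fun i _ => norm_sub_le _ _)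
  -- Step C: squares
  have hT2 : (∑ μ, ‖T μ‖) ^ 2 ≤ (Fintype.card ι : ℝ) * ∑ μ, P μ :=
    (sq_sum_le_card_mul_sum_sq_univ _).trans (mul_le_mul_of_nonneg_left (Finset.sum_le_sum fun μ _ => hP μ) (Nat.cast_nonneg _))
  have hS2 : (∑ j ∈ range (k - 1), W' j * ∑ μ, (‖Δa j μ‖ + ‖Δb j μ‖)) ^ 2
      ≤ (1 - (Real.sqrt L)⁻¹)⁻¹ * ∑ j ∈ range (k - 1), (Real.sqrt L) ^ (k - 2 - j) * (W' j ^ 2 * (2 * (Fintype.card ι : ℝ) * ∑ μ, (Da j μ + Db j μ))) := by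
    have h1 := sq_sum_le_cL_mul_sum hL (k - 1) (fun j => W' j * ∑ μ, (‖Δa j μ‖ + ‖Δb j μ‖))
    refine h1.trans (mul_le_mul_of_nonneg_left (Finset.sum_le_sum fun j hj => ?_) hcL)
    have hjk : j + 1 < k := by have := Finset.mem_range.mp hj; omega
    rw [show k - 1 - 1 - j = k - 2 - j by omega]
    refine mul_le_mul_of_nonneg_left ?_ (pow_pos hs0 _).le
    rw [mul_pow]
    refine mul_le_mul_of_nonneg_left ?_ (sq_nonneg _)
    calc (∑ μ, (‖Δa j μ‖ + ‖Δb j μ‖)) ^ 2 ≤ (Fintype.card ι : ℝ) * ∑ μ, (‖Δa j μ‖ + ‖Δb j μ‖) ^ 2 := sq_sum_le_card_mul_sum_sq_univ _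
      _ ≤ (Fintype.card ι : ℝ) * ∑ μ, (2 * Da j μ + 2 * Db j μ) := by
          refine mul_le_mul_of_nonneg_left (Finset.sum_le_sum fun μ _ => ?_) (Nat.cast_nonneg _)
          exact (add_sq_le_two _ _).trans (add_le_add (mul_le_mul_of_nonneg_left (ha j hjk μ) zero_le_two)
            (mul_le_mul_of_nonneg_left (hb j hjk μ) zero_le_two))
      _ = 2 * (Fintype.card ι : ℝ) * ∑ μ, (Da j μ + Db j μ) := by
          rw [show (∑ μ, (2 * Da j μ + 2 * Db j μ)) = 2 * ∑ μ, (Da j μ + Db j μ) by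
            rw [Finset.mul_sum]; exact Finset.sum_congr rfl fun μ _ => by ring]
          ring
  have hR2 : (∑ i ∈ range k, (‖o i‖ + ‖p i‖)) ^ 2 ≤ (1 - (Real.sqrt L)⁻¹)⁻¹ * ∑ i ∈ range k, (Real.sqrt L) ^ (k - 1 - i) * (2 * (O i + O' i)) := by
    have h1 := sq_sum_le_cL_mul_sum hL k (fun i => ‖o i‖ + ‖p i‖)
    refine h1.trans (mul_le_mul_of_nonneg_left (Finset.sum_le_sum fun i hi => ?_) hcL)
    have hik : i < k := Finset.mem_range.mp hi
    refine mul_le_mul_of_nonneg_left ?_ (pow_pos hs0 _).le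
    calc (‖o i‖ + ‖p i‖) ^ 2 ≤ 2 * ‖o i‖ ^ 2 + 2 * ‖p i‖ ^ 2 := add_sq_le_two _ _
      _ ≤ 2 * O i + 2 * O' i := add_le_add (mul_le_mul_of_nonneg_left (ho i hik) zero_le_two) (mul_le_mul_of_nonneg_left (hp i hik) zero_le_two)
      _ = 2 * (O i + O' i) := by ring
  -- assemble
  have hN0 : 0 ≤ ‖(∑ i ∈ range k, ((∑ μ, w i • a i μ) + o i)) - ∑ i ∈ range k, ((∑ μ, w i • b i μ) + p i)‖ := norm_nonneg _
  have hX0 : 0 ≤ W * ∑ μ, ‖T μ‖ := mul_nonneg hW0 (Finset.sum_nonneg fun μ _ => norm_nonneg _)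
  have hY0 : 0 ≤ ∑ j ∈ range (k - 1), W' j * ∑ μ, (‖Δa j μ‖ + ‖Δb j μ‖) :=
    Finset.sum_nonneg fun j _ => mul_nonneg (hW'0 j) (Finset.sum_nonneg fun μ _ => add_nonneg (norm_nonneg _) (norm_nonneg _))
  have hZ0 : 0 ≤ ∑ i ∈ range k, (‖o i‖ + ‖p i‖) := Finset.sum_nonneg fun i _ => add_nonneg (norm_nonneg _) (norm_nonneg _)
  calc ‖(∑ i ∈ range k, ((∑ μ, w i • a i μ) + o i)) - ∑ i ∈ range k, ((∑ μ, w i • b i μ) + p i)‖ ^ 2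
      ≤ (W * ∑ μ, ‖T μ‖ + ∑ j ∈ range (k - 1), W' j * ∑ μ, (‖Δa j μ‖ + ‖Δb j μ‖) + ∑ i ∈ range k, (‖o i‖ + ‖p i‖)) ^ 2 :=
        pow_le_pow_left₀ hN0 hB 2
    _ ≤ 3 * ((W * ∑ μ, ‖T μ‖) ^ 2 + (∑ j ∈ range (k - 1), W' j * ∑ μ, (‖Δa j μ‖ + ‖Δb j μ‖)) ^ 2 + (∑ i ∈ range k, (‖o i‖ + ‖p i‖)) ^ 2) :=
        add_add_sq_le_three _ _ _
    _ ≤ 3 * (W ^ 2 * ((Fintype.card ι : ℝ) * ∑ μ, P μ)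
          + (1 - (Real.sqrt L)⁻¹)⁻¹ * ∑ j ∈ range (k - 1), (Real.sqrt L) ^ (k - 2 - j) * (W' j ^ 2 * (2 * (Fintype.card ι : ℝ) * ∑ μ, (Da j μ + Db j μ)))
          + (1 - (Real.sqrt L)⁻¹)⁻¹ * ∑ i ∈ range k, (Real.sqrt L) ^ (k - 1 - i) * (2 * (O i + O' i))) := by
        rw [mul_pow]
        gcongr
    _ = _ := by
        rw [hW, hW']
        simp only [Finset.mul_sum]
        ring_nf

end Abstract

/-! ## §2 The letters of ✓`Prop7CornerCombStructure.cornerComb_structure`: the gauge function unrolled along the corner chain -/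

section Letters

open Literature.MathematicalPhysics.QuantumFieldTheory.Balaban1983to89
open B7Prop1Explicit (Site e U1)
open B7Eq78Linearization (conjR conjR_add conjR_sub)
open B7Prop3GeneralRotated (norm_conjR_le)

variable {d : ℕ}

/-- **THE GAUGE FUNCTION UNROLLED ALONG THE CORNER CHAIN**: for the recursion of record `Λ 0 = 0`, `Λ (k+1) z = CM k (G k) z + Λ k (L•z)` (✓`cornerComb_structure`'s `hΛ0`∕`hΛs`, ANY
coarse-site maps `CM`), `Λ k z = Σ_{i<k} CM i (G i) (L^{k−1−i} • z)` — the level-`k` value at the corner `z` reads the `i`-th corner charge at the level-`(i+1)` site `L^{k−1−i}•z` above the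
SAME physical corner. [cite: Balaban1984PropagatorsI, (1.18)-(1.20) pp.19-20; Balaban1985Averaging, (43) p.24] -/
theorem gauge_unroll {𝔸 : Type*} [AddCommMonoid 𝔸] (L : ℕ) (CM : ℕ → (Site d → Fin d → 𝔸) → Site d → 𝔸)
    (G : ℕ → Site d → Fin d → 𝔸) (Λ : ℕ → Site d → 𝔸) (hΛ0 : ∀ z, Λ 0 z = 0)
    (hΛs : ∀ (k : ℕ) (z : Site d), Λ (k + 1) z = CM k (G k) z + Λ k ((L : ℤ) • z)) :
    ∀ (k : ℕ) (z : Site d), Λ k z = ∑ i ∈ range k, CM i (G i) (((L : ℤ) ^ (k - 1 - i)) • z) := by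
  intro k
  induction k with
  | zero => intro z; rw [hΛ0, Finset.range_zero, Finset.sum_empty]
  | succ k ih =>
    intro z
    rw [hΛs, ih, Finset.sum_range_succ, Nat.add_sub_cancel, Nat.sub_self, pow_zero, one_smul, add_comm]
    congr 1
    refine Finset.sum_congr rfl fun i hi => ?_
    rw [Finset.mem_range] at hi
    rw [smul_smul, ← pow_succ, show k - 1 - i + 1 = k - i by omega]

/-- **THE COVARIANT COARSE GRADIENT OF THE GAUGE FUNCTION AS A SUM OVER THE CORNER CHAIN**: with `u` the level-`k` bond variable `Ū₀ᵏ(z,κ)`,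
`Λ k z − Ad_u Λ k (z + e κ) = Σ_{i<k} [CM i (G i)(L^{k−1−i}•z) − Ad_u CM i (G i)(L^{k−1−i}•(z + e κ))]` (`gauge_unroll` at both corners; `Ad_u` is additive).
[cite: Balaban1984PropagatorsI, (1.18)-(1.20) pp.19-20; Balaban1985Averaging, (56) p.27] -/
theorem covGrad_gauge_eq_sum {𝔸 : Type*} [NormedRing 𝔸] (L : ℕ) (CM : ℕ → (Site d → Fin d → 𝔸) → Site d → 𝔸)
    (G : ℕ → Site d → Fin d → 𝔸) (Λ : ℕ → Site d → 𝔸) (hΛ0 : ∀ z, Λ 0 z = 0)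
    (hΛs : ∀ (k : ℕ) (z : Site d), Λ (k + 1) z = CM k (G k) z + Λ k ((L : ℤ) • z)) (u : 𝔸ˣ) (k : ℕ) (z : Site d) (κ : Fin d) :
    Λ k z - conjR u (Λ k (z + e κ))
      = ∑ i ∈ range k, (CM i (G i) (((L : ℤ) ^ (k - 1 - i)) • z) - conjR u (CM i (G i) (((L : ℤ) ^ (k - 1 - i)) • (z + e κ)))) := by
  have hsum : conjR u (∑ i ∈ range k, CM i (G i) (((L : ℤ) ^ (k - 1 - i)) • (z + e κ)))
      = ∑ i ∈ range k, conjR u (CM i (G i) (((L : ℤ) ^ (k - 1 - i)) • (z + e κ))) :=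
    map_sum (AddMonoidHom.mk' (conjR u) (conjR_add u)) _ _
  rw [gauge_unroll L CM G Λ hΛ0 hΛs k z, gauge_unroll L CM G Λ hΛ0 hΛs k (z + e κ), hsum, Finset.sum_sub_distrib]

/-- **TRANSPORT IS NON-EXPANSIVE ON DIFFERENCES**: for a `U1` unit `u`, `‖Ad_u x − Ad_u y‖² ≤ ‖x − y‖²` — the one-scale ∕ oscillation rows at the neighbouring corner `z + e_κ` transfer to the
transported means `b i μ := Ad_u m⁽ⁱ⁾_μ(z + e_κ)` of `normSq_covGrad_le_of_rows` without loss. [cite: Balaban1985Averaging, (56)-(57) p.27] -/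
theorem normSq_conjR_sub_conjR_le {𝔸 : Type*} [NormedRing 𝔸] [NormOneClass 𝔸] {u : 𝔸ˣ} (hu : u ∈ U1 𝔸) (x y : 𝔸) :
    ‖conjR u x - conjR u y‖ ^ 2 ≤ ‖x - y‖ ^ 2 := by
  rw [← conjR_sub]
  exact pow_le_pow_left₀ (norm_nonneg _) (norm_conjR_le hu _) 2

/-- `‖Ad_u x‖² ≤ ‖x‖²` for a `U1` unit `u` (the transported oscillation row). [cite: Balaban1985Averaging, (56)-(57) p.27] -/
theorem normSq_conjR_le {𝔸 : Type*} [NormedRing 𝔸] [NormOneClass 𝔸] {u : 𝔸ˣ} (hu : u ∈ U1 𝔸) (x : 𝔸) :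
    ‖conjR u x‖ ^ 2 ≤ ‖x‖ ^ 2 :=
  pow_le_pow_left₀ (norm_nonneg _) (norm_conjR_le hu _) 2

end Letters

end Summit.QuantumFields.YangMills.Theorems.Prop7CornerCombChainPerCorner
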